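import Summits.NavierStokesRegularity.NavierStokesRegularity.Theses.TerminalTrace
import Summits.NavierStokesRegularity.NavierStokesRegularity.Theorems.TerminalTraceTypeITraceScarL3SqrtTwoApexConsequences
import Summits.NavierStokesRegularity.NavierStokesRegularity.Theorems.TerminalTraceTypeITraceScarL3LogMeanApexWindow
import Summits.NavierStokesRegularity.NavierStokesRegularity.Theorems.TerminalTraceTypeITraceScarL3LocalWeakL3CylinderGaugeFree
import Summits.NavierStokesRegularity.NavierStokesRegularity.Theorems.TerminalTraceTypeITraceScarL3LocalWeakL3SeqGaugeFree
import Summits.NavierStokesRegularity.NavierStokesRegularity.Theorems.TerminalTraceTypeITraceScarL3LayerDecayViscosity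

set_option linter.dupNamespace false

/-!
# Item 18385 BY NAME from the exclusion of ONE «loud survivor» — the kernel-checked survivor portrait
# (nsreg-C26-p1 g3; state of the line `annulus-dichotomy` after ROUND-27…ROUND-34)

Every partial result landed for item `TerminalTrace.TypeITraceScarL3` (stmt-NavierStokesRegularity-18385)
is a FENCE: a class of points `x₀` at which the item's conclusion is proved.  Read contrapositively at a
hypothetical counterexample — a classical Leray–Hopf Type-I (in time) blow-up `(u,p)` on `[0,T)`, a
backward-singular vertex `(T,x₀)`, and an `L³` ball `u(T) ∈ L³(B(x₀,ρ))` — the fences say that the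
SURVIVOR must carry ALL of the following at `x₀` (each clause is the contrapositive of a tree theorem):

* (S1) every eventual Type-I constant is `≥ √(2ν)`: `‖u(t,x)‖ ≤ C/√(T−t)` eventually ⇒ `2ν ≤ C²`
  (T27-C, `typeITraceScarL3_of_eventualRate_sq_lt_two_nu`, p605349);
* (S2) LOG-MEAN `≥ ν`: no measurable local rate `b` on a ball about `x₀` has log-window means
  `∫_{t'}^{t} b² ≤ 2qν·log((T−t')/(T−t)) + K₀` with `q < 1` (T28-C, `typeITraceScarL3_of_logMean_lt`, p611100);
* (S3) the local weak-`L³` quasi-norm on EVERY backward cylinder `(T−R²,T) × B(x₀,R)` is UNBOUNDED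
  (R31, `typeITraceScarL3_of_localWeakL3Cylinder`, p615282 — modulo Seregin 2019/2021 Prop. 1.4 BY NAME);
* (S4) … indeed unbounded along EVERY sequence of times `t_k ↑ T` (R32,
  `typeITraceScarL3_of_localWeakL3Seq`, p615311 — modulo Albritton–Barker 2020 Thm. 3.1 BY NAME);
* (S5) NOT Type I in space at `x₀`: no envelope `‖x − x₀‖·‖u(t,x)‖ ≤ C'` on any backward cylinder
  (`typeITraceScarL3_of_spaceTimeTypeIEnvelope`, p615282 — modulo Seregin BY NAME);
* (S6) the TERMINAL LAYER does not decay below `√σ`: for every radius `ρ₁`, every one-sided Lipschitz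
  companion `C_g/(T−t)` on `B(x₀,ρ₁) × B(x₀,2ρ₁)` is incompatible with the dial
  «∀ ε ∃ τ ∈ (0,1] ∃ l₁ ∀ l ≤ l₁ ∀ x ∈ B(x₀,ρ₁): ∫_{B(x,l)}|u(T−τ²l²/ν)|² ≤ ετl»
  (R33 at every `ν`, `isBackwardBoundedAt_of_terminalLayerDecay`, p616148).

`typeITraceScarL3_of_noSurvivor` records this composition: the item follows, BY NAME, from the two
printed criteria (Literature facts, carried as hypotheses exactly as in the fences) and ONE exclusion
hypothesis `H` — «no point carries (S1)–(S6) together with the item's binders, a singular vertex and an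
`L³` ball».  `H` is the open core (the LOUD survivor of ROUND-27 §3 / ROUND-33 §3) typed at the ITEM
level; it is NOT proved here.  Kernel bookkeeping only: no new analysis.

WHAT THIS IS NOT: not a proof of 18385, not a Type-I exclusion, NOT Navier–Stokes regularity.
-/

noncomputable section

open MeasureTheory Set Function Metric Filter Topology Literature.Analysis.FluidPDE
open scoped ENNReal NNReal

namespace Summit.NavierStokesRegularity.NavierStokesRegularity.Theorems.TypeITraceScarL3

/-- **Item 18385 BY NAME from the exclusion of one loud survivor** (module docstring): modulo the two
printed local criteria carried by name (`seregin2019_localWeakL3_epsRegularity`,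
`albrittonBarker2020_localWeakL3_regularity`), the item `TerminalTrace.TypeITraceScarL3` follows from
the single hypothesis `H`: no classical Leray–Hopf Type-I blow-up has a backward-singular vertex
`(T,x₀)` with an `L³` ball `u(T) ∈ L³(B(x₀,ρ))` carrying the survivor portrait (S1)–(S6) — rate
constants `≥ √(2ν)`, log-mean `≥ ν`, local weak-`L³` unbounded on every backward cylinder and along
every sequence `t_k ↑ T`, no space–time Type-I envelope, no terminal-layer decay below `√σ` under any
Lipschitz companion.  Composition of the landed fences, read contrapositively; `H` is the open core.
[folklore; Seregin2019 Prop. 1.4; AlbrittonBarker2020 Thm. 3.1; Seregin2014 §6; Tao2011 Lemma 4.1 (i)] -/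
theorem typeITraceScarL3_of_noSurvivor
    (hF1 : Literature.Analysis.FluidPDE.seregin2019_localWeakL3_epsRegularity)
    (hFA : Literature.Analysis.FluidPDE.albrittonBarker2020_localWeakL3_regularity)
    (H : ∀ (ν T : ℝ), 0 < ν → 0 < T →
      ∀ (u : ℝ → EuclideanSpace ℝ (Fin 3) → EuclideanSpace ℝ (Fin 3))
        (p : ℝ → EuclideanSpace ℝ (Fin 3) → ℝ),
      IsClassicalNSSolutionOn (Set.Ico 0 T) ν 0 u p → IsLerayHopfOn T ν 0 (u 0) u →
      HasRapidSpatialDecay (u 0) → IsTypeIBlowup u T →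
      ∀ x₀ : EuclideanSpace ℝ (Fin 3),
      (∀ r : ℝ, 0 < r →
        eLpNorm (Function.uncurry u) ⊤ (volume.restrict (parabolicCylinder r (T, x₀))) = ⊤) →
      ∀ ρ : ℝ, 0 < ρ → MemLp (u T) 3 (volume.restrict (ball x₀ ρ)) →
      -- (S1) every eventual Type-I constant is at least `√(2ν)`
      (∀ C : ℝ, (∀ᶠ t in 𝓝[<] T, ∀ x, ‖u t x‖ ≤ C / Real.sqrt (T - t)) → 2 * ν ≤ C ^ 2) →
      -- (S2) log-mean at least `ν`: every admissible log-window exponent is `≥ 1`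
      (∀ (b : ℝ → ℝ) (δb ρb q K₀ : ℝ), Measurable b → 0 < δb → 0 < ρb → 0 ≤ K₀ →
        (∀ t ∈ Ioo (T - δb) T, ∀ x ∈ ball x₀ ρb, ‖u t x‖ ≤ b t) →
        (∀ t' t : ℝ, T - δb < t' → t' ≤ t → t < T →
          ∫⁻ τ in Ioo t' t, ENNReal.ofReal (b τ ^ 2) ≤
            ENNReal.ofReal (2 * q * ν * Real.log ((T - t') / (T - t)) + K₀)) →
        1 ≤ q) →
      -- (S3) local weak-L³ unbounded on every backward cylinder at `x₀`
      (∀ M R : ℝ, 0 < R → R ^ 2 ≤ T →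
        ¬ (∀ t ∈ Ioo (T - R ^ 2) T, ∀ h : ℝ, 0 < h →
          ENNReal.ofReal (h ^ 3) *
              volume.restrict (ball x₀ R) {x : EuclideanSpace ℝ (Fin 3) | h < ‖u t x‖} ≤
            ENNReal.ofReal (M ^ 3))) →
      -- (S4) … and along every sequence of times `t_k ↑ T`
      (∀ (M R : ℝ) (s : ℕ → ℝ), 0 < R → R ^ 2 ≤ T → StrictMono s →
        (∀ k, s k ∈ Ioo (T - R ^ 2) T) → Tendsto s atTop (𝓝 T) →
        ¬ (∀ (k : ℕ) (h : ℝ), 0 < h →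
          ENNReal.ofReal (h ^ 3) *
              volume.restrict (ball x₀ R) {x : EuclideanSpace ℝ (Fin 3) | h < ‖u (s k) x‖} ≤
            ENNReal.ofReal (M ^ 3))) →
      -- (S5) no space–time Type-I envelope at `x₀`
      (∀ C' R : ℝ, 0 < C' → 0 < R → R ^ 2 ≤ T →
        ¬ (∀ t ∈ Ioo (T - R ^ 2) T, ∀ x ∈ ball x₀ R, ‖x - x₀‖ * ‖u t x‖ ≤ C')) →
      -- (S6) no terminal-layer decay below `√σ` under any Lipschitz companion
      (∀ ρ₁ Cg T₀ : ℝ, 0 < ρ₁ → 0 < Cg → T₀ < T →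
        (∀ t ∈ Ioo T₀ T, ∀ x ∈ ball x₀ ρ₁, ∀ y ∈ ball x₀ (2 * ρ₁),
          ‖u t x‖ - ‖u t y‖ ≤ Cg / (T - t) * dist y x) →
        ¬ (∀ ε : ℝ, 0 < ε → ∃ τ : ℝ, 0 < τ ∧ τ ≤ 1 ∧ ∃ l₁ : ℝ, 0 < l₁ ∧
          ∀ l : ℝ, 0 < l → l ≤ l₁ → ∀ x ∈ ball x₀ ρ₁,
            ∫⁻ y in ball x l, ‖u (T - τ ^ 2 * l ^ 2 / ν) y‖ₑ ^ 2 ≤ ENNReal.ofReal (ε * τ * l))) →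
      False) :
    Summit.NavierStokesRegularity.NavierStokesRegularity.Theses.TerminalTrace.TypeITraceScarL3 := by
  intro ν T hν hT u p hcl hLH hdec hTI x₀ hsing ρ hρ hmem
  refine H ν T hν hT u p hcl hLH hdec hTI x₀ hsing ρ hρ hmem ?_ ?_ ?_ ?_ ?_ ?_
  · -- (S1) from T27-C
    intro C hC
    by_contra hlt
    push Not at hlt
    exact typeITraceScarL3_of_eventualRate_sq_lt_two_nu ν T hν hT u p hcl hLH C hlt hC x₀ hsing ρ hρ
      hmem
  · -- (S2) from T28-C, with the item's Type-I constant made nonnegative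
    intro b δb ρb q K₀ hbm hδb hρb hK₀ hb hLM
    by_contra hq
    push Not at hq
    obtain ⟨C, hC⟩ := hTI
    have hC' : ∀ᶠ t in 𝓝[<] T, ∀ x, ‖u t x‖ ≤ max C 0 / Real.sqrt (T - t) := by
      filter_upwards [hC, self_mem_nhdsWithin] with t ht htT x
      have hpos : 0 < Real.sqrt (T - t) := Real.sqrt_pos.2 (sub_pos.2 htT)
      exact (ht x).trans (div_le_div_of_nonneg_right (le_max_left _ _) hpos.le)
    exact typeITraceScarL3_of_logMean_lt ν T hν hT u p hcl hLH (max C 0) (le_max_right _ _) hC' x₀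
      hsing b δb ρb q K₀ hbm hδb hρb hK₀ hq hb hLM ρ hρ hmem
  · -- (S3) from the gauge-free R31 fence
    intro M R hR hRT hW
    exact typeITraceScarL3_of_localWeakL3Cylinder ν T hν hT hF1 u p hcl hLH hdec hTI x₀
      ⟨M, R, hR, hRT, hW⟩ hsing ρ hρ hmem
  · -- (S4) from the gauge-free R32 fence
    intro M R s hR hRT hs hsI hsT hW
    exact typeITraceScarL3_of_localWeakL3Seq ν T hν hT hFA u p hcl hLH hdec hTI x₀
      ⟨M, R, s, hR, hRT, hs, hsI, hsT, hW⟩ hsing ρ hρ hmem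
  · -- (S5) from the gauge-free space–time Type-I fence
    intro C' R hC' hR hRT henv
    exact typeITraceScarL3_of_spaceTimeTypeIEnvelope ν T hν hT hF1 u p hcl hLH hdec hTI x₀
      ⟨C', R, hC', hR, hRT, henv⟩ hsing ρ hρ hmem
  · -- (S6) from the ν-general terminal-layer criterion
    intro ρ₁ Cg T₀ hρ₁ hCg hT₀ hlip hlayer
    exact not_isBackwardBoundedAt_of_forall_eLpNorm_top hsing
      (isBackwardBoundedAt_of_terminalLayerDecay hν hT hcl hLH hTI hρ₁ hCg hT₀ hlip hlayer)

end Summit.NavierStokesRegularity.NavierStokesRegularity.Theorems.TypeITraceScarL3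

end
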